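import Mathlib
import Literature.Combinatorics.Optimization.LpFormulationReductions
import HarnessLib

/-!
# LP and SDP formulations of fractional optimization problems (Braun–Pokutta–Roy 2016, §4)

G. Braun, S. Pokutta, A. Roy, *Strong reductions for extended formulations*, IPCO 2016 / Math. Program. 172 (2018)
[BraunPokuttaRoy2016], §4 "Fractional optimization problems" (arXiv:1512.04932v3 numbering: Def. 4.1 LP formulation of a
fractional optimization problem, Def. 4.2 SDP formulation, Def. 4.3 the `(C,S)`-approximate slack matrix
`M = [M^{(d)}; M^{(n)}]`, `M^{(d)}(𝔍,s) = val^d_𝔍(s)`, `M^{(n)}(𝔍,s) = τ(C(𝔍) val^d_𝔍(s) − val^n_𝔍(s))`, Thm. 4.4 the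
factorization theorem `fc(𝒫,C,S) = rk_LP M`, `fc_SDP(𝒫,C,S) = rk_SDP M`).  "A fractional optimization problem is an
optimization problem where the objectives have the form of a fraction `val_𝔍 = val^n_𝔍/val^d_𝔍`, such as for SparsestCut
… the linear programs are used to find an optimal value of a linear combination of `val^n_𝔍` and `val^d_𝔍` … which reduces
to the original definition with the choice of `val^n_𝔍 = val_𝔍` and `val^d_𝔍 = 1`."

This file TYPES the maximization case (`τ = +1`) over the tree's vocabulary and PROVES the LP factorization theorem in both
directions and the easy half of the SDP one; no named facts:

* `FracMaxProblem σ φ` (`valn`, `vald`, `C`, `S`); `FracMaxProblem.Sound` — the sound instances `𝔍^S = {max val_𝔍 ≤ S(𝔍)}`,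
  RENDERED multiplicatively as `val^n_𝔍(s) ≤ S(𝔍)·val^d_𝔍(s)` for all `s` (equivalent for positive denominators; recorded
  rendering decision); `FracMaxProblem.slackMatrix` — Def. 4.3, rows `Bool × 𝔍^S` (`false` = denominator block,
  `true` = numerator block); `MaxProblem.toFrac` — the case `val^d = 1`.
* `FracLPFormulation P R` — Def. 4.1 verbatim (LP `A x ≤ b` ∋ `x^s`; pairs of affine `w^n_𝔍, w^d_𝔍` exact on the `x^s` for
  sound `𝔍`; `A x ≤ b ⇒ w^d_𝔍(x) ≥ 0` and `w^n_𝔍(x) ≤ C(𝔍) w^d_𝔍(x)`).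
* **Thm. 4.4 (LP)**: `FracLPFormulation.hasNonnegFactorization_slackMatrix` (size `R` formulation ⇒ nonnegative
  factorization of `M` of size `R + 1`: two applications of the affine Farkas lemma
  `Literature.Analysis.Convex.LPDuality.affine_farkas`, to `w^d ≥ 0` and to `C w^d − w^n ≥ 0` over `A x ≤ b`, with a shared
  column factor `(b − A x^s, 1)`), and `FracLPFormulation.ofNonnegFactorization` / `nonempty_of_hasNonnegFactorization`
  (a nonnegative factorization of size `r` IS a formulation of size `r`: LP `x ≥ 0`, `w^d = U_{(d,𝔍)}·x`,
  `w^n = C U_{(d,𝔍)}·x − U_{(n,𝔍)}·x`); hence `fc ≤ nnr(M) ≤ fc + 1` (`isEmpty_of_not_hasNonnegFactorization`), the `±1`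
  being the tree's currency without free affine term (cf. Remark 2.19 in `SdpFormulationReductions.lean`).
* The non-fractional case: `LPFormulation.toFrac` (Def. 2.23 ⇒ Def. 4.1 with `w^d = 1`),
  `MaxProblem.hasNonnegFactorization_toFrac_slackMatrix` (`nnr(M_frac) ≤ nnr(M) + 1`, the all-ones denominator block) and
  `MaxProblem.hasNonnegFactorization_of_toFrac` (`nnr(M) ≤ nnr(M_frac)`, the numerator block is `M`) — "Definitions 4.1
  and 4.2 are equivalent to Definitions 2.23 and 2.24" at slack-matrix level.
* `FracSDPFormulation P d` — Def. 4.2 verbatim; **Thm. 4.4 (SDP), direction "factorization ⇒ formulation"**: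
  `FracSDPFormulation.ofPsdFactorization` / `nonempty_of_hasPsdFactorization` (SDP = the whole cone `𝕊^r_+`,
  `w^d_𝔍(Y) = Tr[A_{(d,𝔍)}Y]`, `w^n_𝔍(Y) = C(𝔍)Tr[A_{(d,𝔍)}Y] − Tr[A_{(n,𝔍)}Y]`, nonnegativity from `Tr[AB] ≥ 0` for psd `A, B`).

Not here: the SDP direction "formulation ⇒ psd factorization" (needs conic duality for the spectrahedron; the
non-fractional analogue is the tree's `SDPFormulation.hasPsdFactorization_slack`), minimization problems (`τ = −1`), and
§4.1 (Def. 4.5 / Thm. 4.6: reductions between fractional problems).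
-/

noncomputable section

open Finset Matrix
open scoped MatrixOrder

namespace Literature.Combinatorics.Optimization

open Literature.Analysis.Convex (LPDuality.affine_farkas)

variable {σ φ : Type*}

/-! ### Fractional maximization problems and their slack matrices (§4, Def. 4.3) -/

/-- A **fractional maximization problem** `𝒫 = (𝒮, 𝔍, val)` with `val_𝔍 = val^n_𝔍 / val^d_𝔍` and guarantees `C, S`.
[cite: BraunPokuttaRoy2016, §4 (arXiv v3)] -/
structure FracMaxProblem (σ : Type*) (φ : Type*) where
  /-- numerator `val^n_𝔍(s)` -/
  valn : φ → σ → ℝ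
  /-- denominator `val^d_𝔍(s)` -/
  vald : φ → σ → ℝ
  /-- completeness guarantee -/
  C : φ → ℝ
  /-- soundness guarantee -/
  S : φ → ℝ

namespace FracMaxProblem

/-- The sound instances `𝔍^S = {𝔍 : max val_𝔍 ≤ S(𝔍)}`, rendered multiplicatively (`val^n_𝔍(s) ≤ S(𝔍)·val^d_𝔍(s)` for all
`s`; this is `max val^n/val^d ≤ S` for positive denominators). [cite: BraunPokuttaRoy2016, Def. 4.1 (arXiv v3)] -/
def Sound (P : FracMaxProblem σ φ) (f : φ) : Prop := ∀ s, P.valn f s ≤ P.S f * P.vald f s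

/-- **Def. 4.3 (the `(C,S)`-approximate slack matrix of a fractional problem)**: the `2𝔍^S × 𝒮` matrix with blocks
`M^{(d)}(𝔍, s) = val^d_𝔍(s)` (tag `false`) and `M^{(n)}(𝔍, s) = C(𝔍)·val^d_𝔍(s) − val^n_𝔍(s)` (tag `true`; `τ = +1`).
[cite: BraunPokuttaRoy2016, Def. 4.3 (arXiv v3)] -/
def slackMatrix (P : FracMaxProblem σ φ) : Bool × {f : φ // P.Sound f} → σ → ℝ
  | (false, f), s => P.vald f.1 s
  | (true, f), s => P.C f.1 * P.vald f.1 s - P.valn f.1 s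

/-- The denominator block. [cite: BraunPokuttaRoy2016, Def. 4.3 (arXiv v3)] -/
@[simp] theorem slackMatrix_false (P : FracMaxProblem σ φ) (f : {f : φ // P.Sound f}) (s : σ) :
    P.slackMatrix (false, f) s = P.vald f.1 s := rfl

/-- The numerator block. [cite: BraunPokuttaRoy2016, Def. 4.3 (arXiv v3)] -/
@[simp] theorem slackMatrix_true (P : FracMaxProblem σ φ) (f : {f : φ // P.Sound f}) (s : σ) :
    P.slackMatrix (true, f) s = P.C f.1 * P.vald f.1 s - P.valn f.1 s := rfl

end FracMaxProblem

/-- An optimization problem is the fractional problem with `val^d = 1` ("reduces to the original definition with the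
choice of `val^n_𝔍 = val_𝔍` and `val^d_𝔍 = 1`"). [cite: BraunPokuttaRoy2016, §4 (arXiv v3)] -/
def MaxProblem.toFrac (P : MaxProblem σ φ) : FracMaxProblem σ φ where
  valn := P.val
  vald _ _ := 1
  C := P.C
  S := P.S

/-- Soundness is unchanged. [cite: BraunPokuttaRoy2016, §4 (arXiv v3)] -/
@[simp] theorem MaxProblem.toFrac_sound (P : MaxProblem σ φ) (f : φ) : P.toFrac.Sound f ↔ P.Sound f := by
  simp [FracMaxProblem.Sound, MaxProblem.Sound, MaxProblem.toFrac]

/-! ### LP formulations of fractional problems (Def. 4.1) and the factorization theorem (Thm. 4.4, LP) -/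

/-- **Def. 4.1 (`(C,S)`-approximate LP formulation of a fractional maximization problem, size `R`)**: a linear program
`A x ≤ b` containing the vectors `x^s`; for every sound instance a PAIR of affine functions `w^n_𝔍, w^d_𝔍`, exact on the
`x^s` (`w^n_𝔍(x^s) = val^n_𝔍(s)`, `w^d_𝔍(x^s) = val^d_𝔍(s)`), with `A x ≤ b ⇒ w^d_𝔍(x) ≥ 0` and `w^n_𝔍(x) ≤ C(𝔍) w^d_𝔍(x)`.
[cite: BraunPokuttaRoy2016, Def. 4.1 (arXiv v3)] -/
structure FracLPFormulation (P : FracMaxProblem σ φ) (R : ℕ) where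
  /-- number of variables -/
  D : ℕ
  /-- constraint matrix -/
  A : Matrix (Fin R) (Fin D) ℝ
  /-- right-hand side -/
  b : Fin R → ℝ
  /-- the vectors `x^s` -/
  x : σ → Fin D → ℝ
  /-- `A x^s ≤ b` -/
  mem : ∀ s i, (A *ᵥ x s) i ≤ b i
  /-- linear part of `w^n_𝔍` -/
  wn : φ → Fin D → ℝ
  /-- constant part of `w^n_𝔍` -/
  cn : φ → ℝ
  /-- linear part of `w^d_𝔍` -/
  wd : φ → Fin D → ℝ
  /-- constant part of `w^d_𝔍` -/
  cd : φ → ℝ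
  /-- `w^n_𝔍(x^s) = val^n_𝔍(s)` for sound `𝔍` -/
  exactn : ∀ f, P.Sound f → ∀ s, wn f ⬝ᵥ x s + cn f = P.valn f s
  /-- `w^d_𝔍(x^s) = val^d_𝔍(s)` for sound `𝔍` -/
  exactd : ∀ f, P.Sound f → ∀ s, wd f ⬝ᵥ x s + cd f = P.vald f s
  /-- `A x ≤ b ⇒ w^d_𝔍(x) ≥ 0` -/
  nonneg : ∀ f, P.Sound f → ∀ y : Fin D → ℝ, (∀ i, (A *ᵥ y) i ≤ b i) → 0 ≤ wd f ⬝ᵥ y + cd f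
  /-- `A x ≤ b ⇒ w^n_𝔍(x) ≤ C(𝔍)·w^d_𝔍(x)` -/
  achieves : ∀ f, P.Sound f → ∀ y : Fin D → ℝ, (∀ i, (A *ᵥ y) i ≤ b i) →
    wn f ⬝ᵥ y + cn f ≤ P.C f * (wd f ⬝ᵥ y + cd f)

variable {R : ℕ}

/-- **Thm. 4.4 (factorization theorem for fractional problems), LP, "formulation ⇒ factorization":** an LP formulation
of size `R` gives a nonnegative factorization of the slack matrix of Def. 4.3 of size `R + 1` — Farkas multipliers for
`w^d_𝔍 ≥ 0` and for `C(𝔍) w^d_𝔍 − w^n_𝔍 ≥ 0` over `A x ≤ b`, substituted at `x^s`, with a common extra column for the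
constants. [cite: BraunPokuttaRoy2016, Thm. 4.4 (LP clause) via Thm. 2.20 (arXiv v3)] -/
theorem FracLPFormulation.hasNonnegFactorization_slackMatrix {P : FracMaxProblem σ φ} (E : FracLPFormulation P R) :
    HasNonnegFactorization P.slackMatrix (R + 1) := by
  classical
  rcases isEmpty_or_nonempty σ with hσ | ⟨⟨s₀⟩⟩
  · exact ⟨fun _ _ => 0, fun _ s => isEmptyElim s, fun _ _ => le_rfl, fun _ s => isEmptyElim s,
      fun _ s => isEmptyElim s⟩
  have hP : ∃ y : Fin E.D → ℝ, E.A *ᵥ y ≤ E.b := ⟨E.x s₀, fun i => E.mem s₀ i⟩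
  -- Farkas multipliers, denominator: `−w^d·y ≤ c^d` on the LP
  have hfd : ∀ f : {f : φ // P.Sound f}, ∃ u : Fin R → ℝ, 0 ≤ u ∧ u ᵥ* E.A = -E.wd f.1 ∧
      u ⬝ᵥ E.b ≤ E.cd f.1 := fun f =>
    LPDuality.affine_farkas E.A E.b (-E.wd f.1) hP fun y hy => by
      have := E.nonneg f.1 f.2 y (fun i => hy i)
      rw [neg_dotProduct]; linarith
  -- Farkas multipliers, numerator: `(w^n − C w^d)·y ≤ C c^d − c^n` on the LP
  have hfn : ∀ f : {f : φ // P.Sound f}, ∃ u : Fin R → ℝ, 0 ≤ u ∧ u ᵥ* E.A = E.wn f.1 - P.C f.1 • E.wd f.1 ∧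
      u ⬝ᵥ E.b ≤ P.C f.1 * E.cd f.1 - E.cn f.1 := fun f =>
    LPDuality.affine_farkas E.A E.b (E.wn f.1 - P.C f.1 • E.wd f.1) hP fun y hy => by
      have := E.achieves f.1 f.2 y (fun i => hy i)
      rw [sub_dotProduct, smul_dotProduct, smul_eq_mul]; linarith
  choose ud hud hudA hudb using hfd
  choose un hun hunA hunb using hfn
  -- row factors: multipliers and the constant slot; column factors: slacks `b − A x^s` and `1`
  refine ⟨fun p => match p with
      | (false, f) => (Fin.snoc (α := fun _ => ℝ) (ud f) (E.cd f.1 - ud f ⬝ᵥ E.b) : Fin (R + 1) → ℝ)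
      | (true, f) => (Fin.snoc (α := fun _ => ℝ) (un f) (P.C f.1 * E.cd f.1 - E.cn f.1 - un f ⬝ᵥ E.b) :
          Fin (R + 1) → ℝ),
    fun l s => (Fin.snoc (α := fun _ => ℝ) (fun i : Fin R => E.b i - (E.A *ᵥ E.x s) i) (1 : ℝ) :
      Fin (R + 1) → ℝ) l, fun p l => ?_, fun l s => ?_, fun p s => ?_⟩
  · rcases p with ⟨_ | _, f⟩
    · refine Fin.lastCases ?_ (fun i => ?_) l
      · simp only [Fin.snoc_last]; linarith [hudb f]
      · simp only [Fin.snoc_castSucc]; exact hud f i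
    · refine Fin.lastCases ?_ (fun i => ?_) l
      · simp only [Fin.snoc_last]; linarith [hunb f]
      · simp only [Fin.snoc_castSucc]; exact hun f i
  · refine Fin.lastCases ?_ (fun i => ?_) l
    · simp
    · simp only [Fin.snoc_castSucc]; linarith [E.mem s i]
  · have hsumd : ∀ u : Fin R → ℝ, ∑ i : Fin R, u i * (E.b i - (E.A *ᵥ E.x s) i) = u ⬝ᵥ E.b - u ⬝ᵥ (E.A *ᵥ E.x s) :=
      fun u => by simp only [dotProduct, mul_sub, sum_sub_distrib]
    rcases p with ⟨_ | _, f⟩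
    · rw [Fin.sum_univ_castSucc]
      simp only [Fin.snoc_castSucc, Fin.snoc_last, mul_one, FracMaxProblem.slackMatrix_false]
      have hws : E.wd f.1 ⬝ᵥ E.x s = -(ud f ⬝ᵥ (E.A *ᵥ E.x s)) := by
        rw [Matrix.dotProduct_mulVec, hudA f, neg_dotProduct, neg_neg]
      have hex := E.exactd f.1 f.2 s
      rw [hsumd]
      linarith
    · rw [Fin.sum_univ_castSucc]
      simp only [Fin.snoc_castSucc, Fin.snoc_last, mul_one, FracMaxProblem.slackMatrix_true]
      have hws : (E.wn f.1 - P.C f.1 • E.wd f.1) ⬝ᵥ E.x s = un f ⬝ᵥ (E.A *ᵥ E.x s) := by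
        rw [← hunA f, Matrix.dotProduct_mulVec]
      rw [sub_dotProduct, smul_dotProduct, smul_eq_mul] at hws
      have hexn := E.exactn f.1 f.2 s
      have hexd := E.exactd f.1 f.2 s
      rw [hsumd]
      linear_combination -hws + hexn - (P.C f.1) * hexd

/-- **Thm. 4.4, LP, "factorization ⇒ formulation"**: a nonnegative factorization of the fractional slack matrix of size
`r` IS an LP formulation of size `r`: the LP is `x ≥ 0`, `x^s` the column factors, `w^d_𝔍(x) = U_{(d,𝔍)}·x`,
`w^n_𝔍(x) = C(𝔍) U_{(d,𝔍)}·x − U_{(n,𝔍)}·x`. [cite: BraunPokuttaRoy2016, Thm. 4.4 (LP clause) via Thm. 2.20 (arXiv v3)] -/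
def FracLPFormulation.ofNonnegFactorization (P : FracMaxProblem σ φ) {r : ℕ}
    (U : Bool × {f : φ // P.Sound f} → Fin r → ℝ) (V : Fin r → σ → ℝ) (hU : ∀ p l, 0 ≤ U p l)
    (hV : ∀ l s, 0 ≤ V l s) (hM : ∀ p s, P.slackMatrix p s = ∑ l, U p l * V l s) : FracLPFormulation P r := by
  classical
  exact
  { D := r
    A := -1
    b := 0
    x := fun s l => V l s
    mem := fun s i => by simp [Matrix.neg_mulVec, hV i s]
    wd := fun f => if h : P.Sound f then U (false, ⟨f, h⟩) else 0
    cd := fun _ => 0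
    wn := fun f => if h : P.Sound f then P.C f • U (false, ⟨f, h⟩) - U (true, ⟨f, h⟩) else 0
    cn := fun _ => 0
    exactd := fun f hf s => by
      have h := hM (false, ⟨f, hf⟩) s
      simp only [FracMaxProblem.slackMatrix_false] at h
      simp only [dif_pos hf, dotProduct, add_zero]
      rw [h]
    exactn := fun f hf s => by
      have hd := hM (false, ⟨f, hf⟩) s
      have hn := hM (true, ⟨f, hf⟩) s
      simp only [FracMaxProblem.slackMatrix_false, FracMaxProblem.slackMatrix_true] at hd hn
      simp only [dif_pos hf, dotProduct, add_zero, Pi.sub_apply, Pi.smul_apply, smul_eq_mul]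
      have : ∑ x, (P.C f * U (false, ⟨f, hf⟩) x - U (true, ⟨f, hf⟩) x) * V x s =
          P.C f * ∑ x, U (false, ⟨f, hf⟩) x * V x s - ∑ x, U (true, ⟨f, hf⟩) x * V x s := by
        rw [mul_sum, ← sum_sub_distrib]
        exact sum_congr rfl fun x _ => by ring
      rw [this, ← hd, ← hn]; ring
    nonneg := fun f hf y hy => by
      have hy' : ∀ l, 0 ≤ y l := fun l => by
        have := hy l; simpa [Matrix.neg_mulVec] using this
      simp only [dif_pos hf, dotProduct, add_zero]
      exact sum_nonneg fun l _ => mul_nonneg (hU _ _) (hy' l)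
    achieves := fun f hf y hy => by
      have hy' : ∀ l, 0 ≤ y l := fun l => by
        have := hy l; simpa [Matrix.neg_mulVec] using this
      simp only [dif_pos hf, sub_dotProduct, smul_dotProduct, smul_eq_mul, add_zero]
      have : 0 ≤ U (true, ⟨f, hf⟩) ⬝ᵥ y := sum_nonneg fun l _ => mul_nonneg (hU _ _) (hy' l)
      linarith }

/-- Existence form. [cite: BraunPokuttaRoy2016, Thm. 4.4 (arXiv v3)] -/
theorem FracLPFormulation.nonempty_of_hasNonnegFactorization {P : FracMaxProblem σ φ} {r : ℕ}
    (h : HasNonnegFactorization P.slackMatrix r) : Nonempty (FracLPFormulation P r) := by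
  obtain ⟨U, V, hU, hV, hM⟩ := h
  exact ⟨FracLPFormulation.ofNonnegFactorization P U V hU hV hM⟩

/-- Lower bounds: `fc(𝒫, C, S) ≥ nnr(M_{𝒫,C,S}) − 1`. [cite: BraunPokuttaRoy2016, Thm. 4.4 (arXiv v3)] -/
theorem FracLPFormulation.isEmpty_of_not_hasNonnegFactorization {P : FracMaxProblem σ φ}
    (h : ¬ HasNonnegFactorization P.slackMatrix (R + 1)) : IsEmpty (FracLPFormulation P R) :=
  ⟨fun E => h E.hasNonnegFactorization_slackMatrix⟩

/-! ### The non-fractional case `val^d = 1` -/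

/-- An LP formulation of `𝒫` is an LP formulation of the fractional problem `𝒫` with `val^d = 1` (`w^d = 1`).
[cite: BraunPokuttaRoy2016, §4 ("Definitions 4.1 and 4.2 are equivalent to Definitions 2.23 and 2.24") (arXiv v3)] -/
def LPFormulation.toFrac {P : MaxProblem σ φ} (E : LPFormulation P R) : FracLPFormulation P.toFrac R where
  D := E.D
  A := E.A
  b := E.b
  x := E.x
  mem := E.mem
  wn := E.w
  cn := E.c
  wd _ := 0
  cd _ := 1
  exactn f hf s := E.exact f ((MaxProblem.toFrac_sound P f).1 hf) s
  exactd f _ s := by simp [MaxProblem.toFrac]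
  nonneg f _ y _ := by simp
  achieves f hf y hy := by
    have := E.achieves f ((MaxProblem.toFrac_sound P f).1 hf) y hy
    simpa [MaxProblem.toFrac] using this

/-- Conversely at slack-matrix level: the fractional slack matrix of `𝒫` with `val^d = 1` consists of the ordinary slack
matrix and an all-ones block, so its nonnegative rank is at most one more.
[cite: BraunPokuttaRoy2016, §4 and Def. 4.3 (arXiv v3)] -/
theorem MaxProblem.hasNonnegFactorization_toFrac_slackMatrix {P : MaxProblem σ φ} {r : ℕ}
    (h : HasNonnegFactorization P.slackMatrix r) : HasNonnegFactorization P.toFrac.slackMatrix (r + 1) := by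
  classical
  obtain ⟨U, V, hU, hV, hM⟩ := h
  refine ⟨fun p => match p with
      | (false, _) => (Fin.snoc (α := fun _ => ℝ) (fun _ : Fin r => (0 : ℝ)) 1 : Fin (r + 1) → ℝ)
      | (true, f) => (Fin.snoc (α := fun _ => ℝ) (U ⟨f.1, (MaxProblem.toFrac_sound P f.1).1 f.2⟩) 0 :
          Fin (r + 1) → ℝ),
    fun l s => (Fin.snoc (α := fun _ => ℝ) (fun l : Fin r => V l s) (1 : ℝ) : Fin (r + 1) → ℝ) l,
    fun p l => ?_, fun l s => ?_, fun p s => ?_⟩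
  · rcases p with ⟨_ | _, f⟩
    · refine Fin.lastCases ?_ (fun i => ?_) l <;> simp
    · refine Fin.lastCases ?_ (fun i => ?_) l
      · simp
      · simp only [Fin.snoc_castSucc]; exact hU _ _
  · refine Fin.lastCases ?_ (fun i => ?_) l
    · simp
    · simp only [Fin.snoc_castSucc]; exact hV _ _
  · rcases p with ⟨_ | _, f⟩
    · rw [Fin.sum_univ_castSucc]
      simp [MaxProblem.toFrac, FracMaxProblem.slackMatrix]
    · rw [Fin.sum_univ_castSucc]
      simp only [Fin.snoc_castSucc, Fin.snoc_last, zero_mul, add_zero, FracMaxProblem.slackMatrix_true]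
      have := hM ⟨f.1, (MaxProblem.toFrac_sound P f.1).1 f.2⟩ s
      simp only [MaxProblem.slackMatrix_apply] at this
      simp only [MaxProblem.toFrac, mul_one]
      rw [this]

/-- And the ordinary slack matrix is a submatrix of the fractional one (the numerator block), so lower bounds transfer
verbatim. [cite: BraunPokuttaRoy2016, Def. 4.3 (arXiv v3)] -/
theorem MaxProblem.hasNonnegFactorization_of_toFrac {P : MaxProblem σ φ} {r : ℕ}
    (h : HasNonnegFactorization P.toFrac.slackMatrix r) : HasNonnegFactorization P.slackMatrix r := by
  obtain ⟨U, V, hU, hV, hM⟩ := h.submatrix (fun f : {f : φ // P.Sound f} =>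
    ((true, ⟨f.1, (MaxProblem.toFrac_sound P f.1).2 f.2⟩) : Bool × {f : φ // P.toFrac.Sound f})) id
  refine ⟨U, V, hU, hV, fun f s => ?_⟩
  rw [← hM f s]
  simp [MaxProblem.toFrac, FracMaxProblem.slackMatrix]

/-! ### SDP formulations of fractional problems (Def. 4.2) and the easy half of Thm. 4.4 (SDP) -/

/-- **Def. 4.2 (`(C,S)`-approximate SDP formulation of a fractional maximization problem, size `d`).**
[cite: BraunPokuttaRoy2016, Def. 4.2 (arXiv v3)] -/
structure FracSDPFormulation (P : FracMaxProblem σ φ) (d : ℕ) where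
  /-- number of linear equality constraints -/
  k : ℕ
  /-- the linear map `𝒜 : 𝕊^d → ℝ^k` -/
  A : Matrix (Fin d) (Fin d) ℝ →ₗ[ℝ] (Fin k → ℝ)
  /-- right-hand side -/
  b : Fin k → ℝ
  /-- the psd matrices `X^s` -/
  X : σ → Matrix (Fin d) (Fin d) ℝ
  posSemidef_X : ∀ s, (X s).PosSemidef
  A_X : ∀ s, A (X s) = b
  /-- linear parts of `w^n_𝔍`, `w^d_𝔍` -/
  wn : φ → Matrix (Fin d) (Fin d) ℝ →ₗ[ℝ] ℝ
  wd : φ → Matrix (Fin d) (Fin d) ℝ →ₗ[ℝ] ℝ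
  /-- constant parts -/
  cn : φ → ℝ
  cd : φ → ℝ
  exactn : ∀ f, P.Sound f → ∀ s, wn f (X s) + cn f = P.valn f s
  exactd : ∀ f, P.Sound f → ∀ s, wd f (X s) + cd f = P.vald f s
  nonneg : ∀ f, P.Sound f → ∀ Y : Matrix (Fin d) (Fin d) ℝ, Y.PosSemidef → A Y = b → 0 ≤ wd f Y + cd f
  achieves : ∀ f, P.Sound f → ∀ Y : Matrix (Fin d) (Fin d) ℝ, Y.PosSemidef → A Y = b →
    wn f Y + cn f ≤ P.C f * (wd f Y + cd f)

/-- `Y ↦ Tr[G Y]` as a linear functional. [folklore] -/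
private def trMulLin {r : ℕ} (G : Matrix (Fin r) (Fin r) ℝ) : Matrix (Fin r) (Fin r) ℝ →ₗ[ℝ] ℝ where
  toFun Y := (G * Y).trace
  map_add' Y Z := by simp only [Matrix.mul_add, trace_add]
  map_smul' a Y := by simp only [Matrix.mul_smul, trace_smul, smul_eq_mul, RingHom.id_apply]

/-- Unfolding `trMulLin`. [folklore] -/
@[simp] private theorem trMulLin_apply {r : ℕ} (G Y : Matrix (Fin r) (Fin r) ℝ) : trMulLin G Y = (G * Y).trace := rfl

/-- `Tr[A B] ≥ 0` for real psd `A, B`. [folklore] -/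
private theorem trace_mul_nonneg_of_psd {r : ℕ} {A B : Matrix (Fin r) (Fin r) ℝ}
    (hA : A.PosSemidef) (hB : B.PosSemidef) : 0 ≤ (A * B).trace := by
  set S : Matrix (Fin r) (Fin r) ℝ := CFC.sqrt A with hS
  have hSpsd : S.PosSemidef := (CFC.sqrt_nonneg A).posSemidef
  have hSS : S * S = A := CFC.sqrt_mul_sqrt_self A hA.nonneg
  have hSH : Sᴴ = S := hSpsd.1
  have hM : (S * B * Sᴴ).PosSemidef := hB.mul_mul_conjTranspose_same S
  have htrM : (S * B * Sᴴ).trace = (A * B).trace := by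
    rw [hSH, Matrix.mul_assoc, trace_mul_comm, Matrix.mul_assoc, hSS, trace_mul_comm]
  rw [← htrM]
  exact hM.trace_nonneg

/-- **Thm. 4.4, SDP, "factorization ⇒ formulation"**: a psd factorization of the fractional slack matrix of size `r` IS an
SDP formulation of size `r` (the SDP is the whole cone `𝕊^r_+`; `w^d_𝔍(Y) = Tr[A_{(d,𝔍)} Y]`,
`w^n_𝔍(Y) = C(𝔍) Tr[A_{(d,𝔍)} Y] − Tr[A_{(n,𝔍)} Y]`).  (The converse needs conic duality and is not typed here.)
[cite: BraunPokuttaRoy2016, Thm. 4.4 (SDP clause) via Thm. 2.20 (arXiv v3)] -/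
def FracSDPFormulation.ofPsdFactorization (P : FracMaxProblem σ φ) {r : ℕ}
    (Af : Bool × {f : φ // P.Sound f} → Matrix (Fin r) (Fin r) ℝ) (B : σ → Matrix (Fin r) (Fin r) ℝ)
    (hA : ∀ p, (Af p).PosSemidef) (hB : ∀ s, (B s).PosSemidef)
    (hM : ∀ p s, P.slackMatrix p s = (Af p * B s).trace) : FracSDPFormulation P r := by
  classical
  exact
  { k := 0
    A := 0
    b := 0
    X := B
    posSemidef_X := hB
    A_X := fun s => Subsingleton.elim _ _
    wd := fun f => if h : P.Sound f then trMulLin (Af (false, ⟨f, h⟩)) else 0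
    cd := fun _ => 0
    wn := fun f => if h : P.Sound f then P.C f • trMulLin (Af (false, ⟨f, h⟩)) - trMulLin (Af (true, ⟨f, h⟩)) else 0
    cn := fun _ => 0
    exactd := fun f hf s => by
      have h := hM (false, ⟨f, hf⟩) s
      simp only [FracMaxProblem.slackMatrix_false] at h
      simp only [dif_pos hf, add_zero, trMulLin_apply]
      rw [h]
    exactn := fun f hf s => by
      have hd := hM (false, ⟨f, hf⟩) s
      have hn := hM (true, ⟨f, hf⟩) s
      simp only [FracMaxProblem.slackMatrix_false, FracMaxProblem.slackMatrix_true] at hd hn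
      simp only [dif_pos hf, add_zero, LinearMap.sub_apply, LinearMap.smul_apply, smul_eq_mul, trMulLin_apply]
      rw [← hd, ← hn]; ring
    nonneg := fun f hf Y hY _ => by
      simp only [dif_pos hf, add_zero, trMulLin_apply]
      exact trace_mul_nonneg_of_psd (hA _) hY
    achieves := fun f hf Y hY _ => by
      simp only [dif_pos hf, add_zero, LinearMap.sub_apply, LinearMap.smul_apply, smul_eq_mul, trMulLin_apply]
      have : 0 ≤ (Af (true, ⟨f, hf⟩) * Y).trace := trace_mul_nonneg_of_psd (hA _) hY
      linarith }

/-- Existence form. [cite: BraunPokuttaRoy2016, Thm. 4.4 (SDP clause) (arXiv v3)] -/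
theorem FracSDPFormulation.nonempty_of_hasPsdFactorization {P : FracMaxProblem σ φ} {r : ℕ}
    (h : HasPsdFactorization P.slackMatrix r) : Nonempty (FracSDPFormulation P r) := by
  obtain ⟨A, B, hA, hB, hM⟩ := h
  exact ⟨FracSDPFormulation.ofPsdFactorization P A B hA hB hM⟩

end Literature.Combinatorics.Optimization

end
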